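import Mathlib.Algebra.BigOperators.Group.Finset.Basic
import Mathlib.Data.Finset.Powerset
import Mathlib.Data.Finset.Prod
import Mathlib.Algebra.Ring.Defs
import HarnessLib

/-!
# One-step scheme: the THREE-COPY FIBRE FORM of a threshold trace (review-queued definitions, D-0009)

Definitions file (prover prim-ineq-prove-3 gen 16; `--supports stmt-CriticalPhenomena-4575`; memo
`run/shared/lean/prim/prim-ineq-prove-3/FINDING-G16-FIBRE-MAJ5.md` §2.3, §3.6, §3.8).  For disjoint coordinate sets `D₁` (coordinates lying in exactly one
of the three copies) and `D₂` (exactly two), a threshold `θ` and two functions `u, v` on patterns, `f3sum R D₁ D₂ θ u v` is the fibre sum of the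
three-copy summand of the one-step quantity `n` for the threshold trace `h = [θ ≤ |·|]`: the sum over `X₁ ⊔ X₂ ⊆ D₁`, `Y₁ ⊔ Y₂ ⊆ D₂` of
`f3term`, the summand evaluated at the copies `S₀ = (D₂∖Y₁) ∪ X₁`, `S₁ = (D₂∖Y₂) ∪ X₂`, `S₂ = (Y₁∪Y₂) ∪ (D₁∖(X₁∪X₂))`.  The ring `R` is a parameter so
that the same form can be evaluated over `ℤ` (by computation) and over `ℝ` (in the one-step scheme).
-/

namespace Summit.CriticalPhenomena.PercolationContinuityZ3.Theorems

namespace SahiOneStep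

open Finset

variable {κ : Type*} [DecidableEq κ]

/-- The threshold indicator `[θ ≤ |S|]` in a ring `R`. -/
def thrR (R : Type*) [Zero R] [One R] (θ : ℕ) (S : Finset κ) : R := if θ ≤ S.card then 1 else 0

/-- The index set of a three-copy fibre: quadruples `((X₁, X₂), (Y₁, Y₂))` with `X₁, X₂ ⊆ D₁` disjoint and `Y₁, Y₂ ⊆ D₂` disjoint. -/
def f3quads (D₁ D₂ : Finset κ) : Finset ((Finset κ × Finset κ) × (Finset κ × Finset κ)) :=
  ((D₁.powerset ×ˢ D₁.powerset) ×ˢ (D₂.powerset ×ˢ D₂.powerset)).filter (fun q => Disjoint q.1.1 q.1.2 ∧ Disjoint q.2.1 q.2.2)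

/-- Copy `S₀` of the quadruple `q = ((X₁, X₂), (Y₁, Y₂))`: `(D₂ ∖ Y₁) ∪ X₁`. -/
def f3S0 (D₂ : Finset κ) (q : (Finset κ × Finset κ) × (Finset κ × Finset κ)) : Finset κ := (D₂ \ q.2.1) ∪ q.1.1

/-- Copy `S₁` of the quadruple `q = ((X₁, X₂), (Y₁, Y₂))`: `(D₂ ∖ Y₂) ∪ X₂`. -/
def f3S1 (D₂ : Finset κ) (q : (Finset κ × Finset κ) × (Finset κ × Finset κ)) : Finset κ := (D₂ \ q.2.2) ∪ q.1.2

/-- Copy `S₂` of the quadruple `q = ((X₁, X₂), (Y₁, Y₂))`: `(Y₁ ∪ Y₂) ∪ (D₁ ∖ (X₁ ∪ X₂))`. -/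
def f3S2 (D₁ : Finset κ) (q : (Finset κ × Finset κ) × (Finset κ × Finset κ)) : Finset κ := (q.2.1 ∪ q.2.2) ∪ (D₁ \ (q.1.1 ∪ q.1.2))

/-- The three-copy summand of `n` for the threshold trace `h = [θ ≤ |·|]`, at the quadruple `q`:
`h(S₁)u(S₁)·h(S₂)v(S₂) + h(S₁)u(S₁)v(S₁)·(1 − h(S₀)) + h(S₀)·u(S₁)·v(S₂) − h(S₁)u(S₁)·v(S₂) − u(S₁)·h(S₂)v(S₂)`. -/
def f3term (R : Type*) [CommRing R] (D₁ D₂ : Finset κ) (θ : ℕ) (u v : Finset κ → R)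
    (q : (Finset κ × Finset κ) × (Finset κ × Finset κ)) : R :=
  thrR R θ (f3S1 D₂ q) * u (f3S1 D₂ q) * (thrR R θ (f3S2 D₁ q) * v (f3S2 D₁ q))
    + thrR R θ (f3S1 D₂ q) * u (f3S1 D₂ q) * v (f3S1 D₂ q) * (1 - thrR R θ (f3S0 D₂ q))
    + thrR R θ (f3S0 D₂ q) * u (f3S1 D₂ q) * v (f3S2 D₁ q)
    - thrR R θ (f3S1 D₂ q) * u (f3S1 D₂ q) * v (f3S2 D₁ q)
    - u (f3S1 D₂ q) * (thrR R θ (f3S2 D₁ q) * v (f3S2 D₁ q))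

/-- **The three-copy fibre form** of a threshold trace: `Σ_{q ∈ f3quads D₁ D₂} f3term q`. -/
def f3sum (R : Type*) [CommRing R] (D₁ D₂ : Finset κ) (θ : ℕ) (u v : Finset κ → R) : R :=
  ∑ q ∈ f3quads D₁ D₂, f3term R D₁ D₂ θ u v q

end SahiOneStep

end Summit.CriticalPhenomena.PercolationContinuityZ3.Theorems
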